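import Mathlib
import Summits.Ventures.LatticeQCDFlow.TrivializingMaps.SeriesSummation
import Summits.Ventures.LatticeQCDFlow.TrivializingMaps.GradedSupBounds
import Summits.Ventures.LatticeQCDFlow.TrivializingMaps.FisherRadiusCap
import Summits.Ventures.LatticeQCDFlow.TrivializingMaps.NormalisedSeries
import Summits.Ventures.LatticeQCDFlow.TrivializingMaps.PoissonSolver
import HarnessLib

/-!
# Summing Lüscher's flow-action series, III: the Wilson flow action `S̃_t = ∑ t^k S̃^{(k)}` solves (4.5)

HONEST FRAMING: exact (Metropolis-corrected) sampling algorithms for lattice gauge theory; figures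
of merit are autocorrelation/cost numbers at stated couplings and volumes; no continuum-physics claim.
Statements about Lüscher's construction for the SU(n) Wilson plaquette action `β·S_W` on FINITE periodic
lattices `(ℤ/L)^d`; "volume-uniform" = the radius does not depend on `L`.

M. Lüscher, CMP 293 (2010) 899–919 [Luscher2010Trivializing], §4.3 (4.11)–(4.15), §4.5(b), App. E.  Lüscher
solves the flow equation `𝓛_t S̃_t = S + Ċ_t` (4.5) by the power series (4.11) and proves (App. E) that on a
FIXED finite lattice the series converges for `|t| < r(L)`, "but this bound is rather poor and vanishes in
the infinite-volume limit"; THEORY-1-LEANMAP §C listed the identification "the series IS the flow action on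
the disc" as PAPER ONLY.  With THEOREM A (`GradedTheoremA`), the manifold sup bounds of
`GradedSupBounds` and the abstract summation theorem `SeriesSummation.luscherL_tSeries_eq`, it is now a
TREE THEOREM, with a VOLUME-UNIFORM radius, for the Wilson action:

* `luscherL_wilsonSeries_eq` — for every `d`, `n ≠ 0`, basis `B`, volume `L`, coupling `β` and flow time
  `t` with `|t|·|β| < θ₁(d,n,B)⁻¹`: the series `S̃_t(W) = ∑_k t^k β^{k+1} S̃^{(k)}(W)` built on the
  Casimir-graded solution `gradedSk B k` SOLVES LÜSCHER'S FLOW EQUATION for `β·S_W` on `SU(n)^E`,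
  `𝓛_t S̃_t = β S_W + Ċ_t`, `Ċ_t = ∑_k t^k β^{k+1} Ċ^{(k)}`;
* `linkDeriv_wilsonSeries_eq`, `summable_…` — its gradient is the (absolutely convergent) gradient series;
* `seriesConverges_smul_ambWilsonAction` — **the body of the cited `SeriesConvergesFiniteVolume`
  (file B, App. E) for `S = β·S_W`, with a radius `r = (|β| θ₁ + 1)⁻¹ > 0` that does NOT depend on `L`**: for
  every smooth HAAR-NORMALISED Lüscher series `(S̃^{(k)}, Ċ^{(k)})` of `β·S_W` and `|t| < r`, the value,
  gradient and constants series converge absolutely on `SU(n)^E` and the sum solves (4.5) (transfer from the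
  graded solution by uniqueness up to constants, `NormalisedSeries`, `SeriesUniqueness`).

No definition is introduced (the series is written out).  Authored by the pub-lqcd lean-2 seat (cell
lqcd-flow, FANOUT row 31 GEN-4). Tags: [ours] = venture work.
-/

noncomputable section

namespace Summit.Ventures.LatticeQCDFlow.TrivializingMaps

open MeasureTheory
open Literature.MathematicalPhysics.QuantumFieldTheory
open Literature.MathematicalPhysics.QuantumFieldTheory.Luscher2010
open scoped Matrix Matrix.Norms.Frobenius ContDiff Topology

namespace GradedSeries

open SeriesSummation

variable {d L n : ℕ} [NeZero L] (B : SuBasis n)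

/-! ## §1. Geometric bookkeeping -/

omit [NeZero L] in
/-- `∑_k (k+1) q^k` converges for `0 ≤ q < 1`. [folklore] -/
theorem summable_succ_mul_geometric {q : ℝ} (hq0 : 0 ≤ q) (hq1 : q < 1) :
    Summable fun k : ℕ => ((k : ℝ) + 1) * q ^ k := by
  have h1 : Summable fun k : ℕ => (k : ℝ) ^ 1 * q ^ k :=
    summable_pow_mul_geometric_of_norm_lt_one 1 (by rw [Real.norm_of_nonneg hq0]; exact hq1)
  simp only [pow_one] at h1
  have h2 : Summable fun k : ℕ => q ^ k := summable_geometric_of_lt_one hq0 hq1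
  simpa [add_mul] using h1.add h2

omit [NeZero L] in
/-- The majorant bookkeeping: `∑_k |t|^k · |β|^{k+1} · (P(k) · (N θ^k))` converges whenever
`∑_k P(k) (|t||β|θ)^k` does. [folklore] -/
theorem summable_majorant {t β N θ : ℝ} {P : ℕ → ℝ}
    (hP : Summable fun k : ℕ => P k * (|t| * |β| * θ) ^ k) :
    Summable fun k : ℕ => |t| ^ k * (|β| ^ (k + 1) * (P k * (N * θ ^ k))) := by
  have h := hP.mul_left (|β| * N)
  refine h.congr fun k => ?_
  rw [mul_pow, mul_pow, pow_succ]
  ring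

/-- The rate: `q = |t|·|β|·θ₁ ∈ [0,1)` when `|t|·|β| < θ₁⁻¹`. [ours] -/
theorem rate_lt_one {t β : ℝ} (h : |t| * |β| < (theta1 d n B)⁻¹) :
    0 ≤ |t| * |β| * theta1 d n B ∧ |t| * |β| * theta1 d n B < 1 := by
  have hθ : 0 < theta1 d n B := zero_lt_one.trans_le (one_le_theta1 d n B)
  refine ⟨mul_nonneg (mul_nonneg (abs_nonneg t) (abs_nonneg β)) hθ.le, ?_⟩
  calc |t| * |β| * theta1 d n B < (theta1 d n B)⁻¹ * theta1 d n B := mul_lt_mul_of_pos_right h hθ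
    _ = 1 := inv_mul_cancel₀ hθ.ne'

/-- **The three majorant series converge** for `|t|·|β| < θ₁⁻¹` (geometric, resp. `(k+1)`-geometric).
[ours] -/
theorem majorants_summable {t β : ℝ} (h : |t| * |β| < (theta1 d n B)⁻¹) :
    (Summable fun k : ℕ => |t| ^ k * (|β| ^ (k + 1) *
        (((Real.sqrt ((n : ℝ) / 4))⁻¹ * (Fintype.card (Edge d L) : ℝ)) * (N0 d n * theta1 d n B ^ k)))) ∧
    (Summable fun k : ℕ => |t| ^ k * (|β| ^ (k + 1) * (1 * (N0 d n * theta1 d n B ^ k)))) ∧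
    (Summable fun k : ℕ => |t| ^ k * (|β| ^ (k + 1) *
        ((((k : ℝ) + 1) * tauStar B) * (N0 d n * theta1 d n B ^ k)))) := by
  obtain ⟨hq0, hq1⟩ := rate_lt_one B h
  have hg := summable_geometric_of_lt_one hq0 hq1
  refine ⟨summable_majorant (P := fun _ => (Real.sqrt ((n : ℝ) / 4))⁻¹ * (Fintype.card (Edge d L) : ℝ))
      (hg.mul_left _), summable_majorant (P := fun _ => (1 : ℝ)) (hg.mul_left _),
    summable_majorant (P := fun k : ℕ => ((k : ℝ) + 1) * tauStar B) ?_⟩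
  refine ((summable_succ_mul_geometric hq0 hq1).mul_left (tauStar B)).congr fun k => ?_
  ring

/-! ## §2. The graded Wilson flow-action series: majorants -/

section Majorants

variable (hn : n ≠ 0) (β : ℝ)
include hn

/-- Values: `|β^{k+1} S̃^{(k)}(ιU)| ≤ |β|^{k+1} · (n/4)^{-1/2} #E · N₀ θ₁^k`. [ours] -/
theorem abs_smul_gradedSk_le (k : ℕ) (U : GaugeConfig d L (Matrix.specialUnitaryGroup (Fin n) ℂ)) :
    |β ^ (k + 1) * gradedSk (d := d) (L := L) B k (WilsonFlow.coeConfig U)|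
      ≤ |β| ^ (k + 1) * (((Real.sqrt ((n : ℝ) / 4))⁻¹ * (Fintype.card (Edge d L) : ℝ)) *
          (N0 d n * theta1 d n B ^ k)) := by
  rw [abs_mul, abs_pow]
  exact mul_le_mul_of_nonneg_left (abs_gradedSk_le B hn k U) (pow_nonneg (abs_nonneg β) _)

/-- Gradients: `|∂^a_e (β^{k+1} S̃^{(k)})(ιU)| ≤ |β|^{k+1} · 1 · N₀ θ₁^k`. [ours] -/
theorem abs_linkDeriv_smul_gradedSk_le (k : ℕ) (U : GaugeConfig d L (Matrix.specialUnitaryGroup (Fin n) ℂ))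
    (e : Edge d L) (a : B.ι) :
    |linkDeriv e (B.T a) (fun W => β ^ (k + 1) * gradedSk (d := d) (L := L) B k W) (WilsonFlow.coeConfig U)|
      ≤ |β| ^ (k + 1) * (1 * (N0 d n * theta1 d n B ^ k)) := by
  rw [linkDeriv_const_mul', abs_mul, abs_pow, one_mul]
  exact mul_le_mul_of_nonneg_left (abs_linkDeriv_gradedSk_le B hn k U e a) (pow_nonneg (abs_nonneg β) _)

/-- Repeated derivatives: `|∂^a_e∂^a_e (β^{k+1} S̃^{(k)})(ιU)| ≤ |β|^{k+1} · (k+1)τ_* · N₀ θ₁^k`. [ours] -/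
theorem abs_linkDeriv_linkDeriv_smul_gradedSk_le (k : ℕ)
    (U : GaugeConfig d L (Matrix.specialUnitaryGroup (Fin n) ℂ)) (e : Edge d L) (a : B.ι) :
    |linkDeriv e (B.T a) (linkDeriv e (B.T a) (fun W => β ^ (k + 1) * gradedSk (d := d) (L := L) B k W))
        (WilsonFlow.coeConfig U)|
      ≤ |β| ^ (k + 1) * ((((k : ℝ) + 1) * tauStar B) * (N0 d n * theta1 d n B ^ k)) := by
  have h1 : linkDeriv e (B.T a) (fun W => β ^ (k + 1) * gradedSk (d := d) (L := L) B k W) =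
      fun W => β ^ (k + 1) * linkDeriv e (B.T a) (gradedSk (d := d) (L := L) B k) W :=
    funext fun W => linkDeriv_const_mul' e (B.T a) _ _ W
  rw [h1, linkDeriv_const_mul', abs_mul, abs_pow]
  exact mul_le_mul_of_nonneg_left (abs_linkDeriv_linkDeriv_gradedSk_le B hn k U e a)
    (pow_nonneg (abs_nonneg β) _)

end Majorants

/-! ## §3. The summed series solves the flow equation for `β·S_W` -/

/-- The scaled graded series `(β^{k+1} S̃^{(k)}, β^{k+1} Ċ^{(k)})` is a smooth Lüscher series of `β·S_W`.
[ours] -/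
theorem isLuscherSeries_smul_gradedSk (β : ℝ) :
    IsLuscherSeries B (fun W => β * ambWilsonAction W)
      (fun k W => β ^ (k + 1) * gradedSk (d := d) (L := L) B k W)
      (fun k => β ^ (k + 1) * gradedConst (d := d) (L := L) B k) :=
  (isLuscherSeries_gradedSk B).smul β

/-- Smoothness of the scaled terms. [ours] -/
theorem contDiff_smul_gradedSk (β : ℝ) (k : ℕ) :
    ContDiff ℝ ∞ (fun W => β ^ (k + 1) * gradedSk (d := d) (L := L) B k W) :=
  contDiff_const.mul (contDiff_gradedSk B k)

/-- The graded constants inherit THEOREM A's rate: `∑_k |Ċ^{(k)}| r^k < ∞` for `0 ≤ r < θ₁⁻¹`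
(`FisherRadiusCap`). [ours] -/
theorem summable_abs_gradedConst_mul_pow (hn : n ≠ 0) {r : ℝ} (hr0 : 0 ≤ r) (hr : r < (theta1 d n B)⁻¹) :
    Summable fun k => |gradedConst (d := d) (L := L) B k| * r ^ k := by
  have hθ : 0 < theta1 d n B := zero_lt_one.trans_le (one_le_theta1 d n B)
  refine IsLuscherSeries.summable_abs_const_mul_pow (isLuscherSeries_gradedSk (d := d) (L := L) B)
    contDiff_ambWilsonAction
    (contDiff_gradedSk (d := d) (L := L) B) (inv_pos.2 hθ) (C := N0 d n) (fun k U e a => ?_) hr0 hr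
  rw [inv_inv]
  exact abs_linkDeriv_gradedSk_le B hn k U e a

/-- The constants' majorant for the scaled series: `∑_k |t|^k |β^{k+1} Ċ^{(k)}| < ∞` for `|t||β| < θ₁⁻¹`.
[ours] -/
theorem summable_abs_smul_gradedConst (hn : n ≠ 0) {t β : ℝ} (h : |t| * |β| < (theta1 d n B)⁻¹) :
    Summable fun k => |t| ^ k * |β ^ (k + 1) * gradedConst (d := d) (L := L) B k| := by
  have hs := (summable_abs_gradedConst_mul_pow (d := d) (L := L) B hn
    (mul_nonneg (abs_nonneg t) (abs_nonneg β)) h).mul_left |β|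
  refine hs.congr fun k => ?_
  rw [abs_mul, abs_pow, mul_pow, pow_succ]
  ring

/-- **The summed Lüscher series is a flow action for the Wilson theory, volume-uniformly.**  For every
`d`, `n ≠ 0`, orthonormal basis `B` of `𝔰𝔲(n)`, every volume `L`, coupling `β` and flow time `t` with
`|t|·|β| < θ₁(d,n,B)⁻¹` (a radius independent of `L`), the series `S̃_t = ∑_k t^k β^{k+1} S̃^{(k)}` built
on the Casimir-graded solution of Lüscher's recursion solves `𝓛_t S̃_t = β S_W + Ċ_t` on `SU(n)^E`,
`Ċ_t = ∑_k t^k β^{k+1} Ċ^{(k)}` — Lüscher's equation (4.5) for the action `β·S_W`, §4.3's programme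
carried out with a volume-uniform radius. [ours; cite: Luscher2010Trivializing, §4.2 eq. (4.5), §4.3, §4.5(b)] -/
theorem luscherL_wilsonSeries_eq (hn : n ≠ 0) {t β : ℝ} (h : |t| * |β| < (theta1 d n B)⁻¹)
    (U : GaugeConfig d L (Matrix.specialUnitaryGroup (Fin n) ℂ)) :
    luscherL B (fun W => β * ambWilsonAction W) t
        (fun W => ∑' k, t ^ k * (β ^ (k + 1) * gradedSk (d := d) (L := L) B k W)) (WilsonFlow.coeConfig U) =
      β * ambWilsonAction (WilsonFlow.coeConfig U) +
        ∑' k, t ^ k * (β ^ (k + 1) * gradedConst (d := d) (L := L) B k) := by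
  obtain ⟨h₀, h₁, h₂⟩ := majorants_summable (L := L) B h
  exact luscherL_tSeries_eq B (isLuscherSeries_smul_gradedSk B β) (contDiff_smul_gradedSk B β)
    (abs_smul_gradedSk_le B hn β) (abs_linkDeriv_smul_gradedSk_le B hn β)
    (abs_linkDeriv_linkDeriv_smul_gradedSk_le B hn β) h₀ h₁ h₂ (summable_abs_smul_gradedConst B hn h) U

/-- **The gradient of the summed flow action is the gradient series** on `SU(n)^E` (`|t||β| < θ₁⁻¹`).
[ours] -/
theorem linkDeriv_wilsonSeries_eq (hn : n ≠ 0) {t β : ℝ} (h : |t| * |β| < (theta1 d n B)⁻¹)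
    (U : GaugeConfig d L (Matrix.specialUnitaryGroup (Fin n) ℂ)) (e : Edge d L) (a : B.ι) :
    linkDeriv e (B.T a) (fun W => ∑' k, t ^ k * (β ^ (k + 1) * gradedSk (d := d) (L := L) B k W))
        (WilsonFlow.coeConfig U) =
      ∑' k, t ^ k * linkDeriv e (B.T a) (fun W => β ^ (k + 1) * gradedSk (d := d) (L := L) B k W)
        (WilsonFlow.coeConfig U) := by
  obtain ⟨h₀, h₁, -⟩ := majorants_summable (L := L) B h
  exact linkDeriv_tSeries B (contDiff_smul_gradedSk B β) (abs_smul_gradedSk_le B hn β)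
    (abs_linkDeriv_smul_gradedSk_le B hn β) h₀ h₁ U e a

/-- The value series converges absolutely on `SU(n)^E` (`|t||β| < θ₁⁻¹`). [ours] -/
theorem summable_wilsonSeries (hn : n ≠ 0) {t β : ℝ} (h : |t| * |β| < (theta1 d n B)⁻¹)
    (U : GaugeConfig d L (Matrix.specialUnitaryGroup (Fin n) ℂ)) :
    Summable fun k => |t| ^ k * |β ^ (k + 1) * gradedSk (d := d) (L := L) B k (WilsonFlow.coeConfig U)| := by
  obtain ⟨h₀, -, -⟩ := majorants_summable (L := L) B h
  refine Summable.of_nonneg_of_le (fun k => by positivity) (fun k => ?_) h₀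
  exact mul_le_mul_of_nonneg_left (abs_smul_gradedSk_le B hn β k U) (pow_nonneg (abs_nonneg t) k)

/-- The gradient series converges absolutely on `SU(n)^E` (`|t||β| < θ₁⁻¹`). [ours] -/
theorem summable_linkDeriv_wilsonSeries (hn : n ≠ 0) {t β : ℝ} (h : |t| * |β| < (theta1 d n B)⁻¹)
    (U : GaugeConfig d L (Matrix.specialUnitaryGroup (Fin n) ℂ)) (e : Edge d L) (a : B.ι) :
    Summable fun k => |t| ^ k *
      |linkDeriv e (B.T a) (fun W => β ^ (k + 1) * gradedSk (d := d) (L := L) B k W) (WilsonFlow.coeConfig U)| := by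
  obtain ⟨-, h₁, -⟩ := majorants_summable (L := L) B h
  refine Summable.of_nonneg_of_le (fun k => by positivity) (fun k => ?_) h₁
  exact mul_le_mul_of_nonneg_left (abs_linkDeriv_smul_gradedSk_le B hn β k U e a)
    (pow_nonneg (abs_nonneg t) k)

/-! ## §4. The cited convergence statement for `β·S_W`, volume-uniformly -/

/-- From `|t| < (|β|θ₁ + 1)⁻¹` to the working hypothesis `|t|·|β| < θ₁⁻¹`. [ours] -/
theorem abs_mul_abs_lt_of_lt_radius {t β : ℝ} (ht : |t| < (|β| * theta1 d n B + 1)⁻¹) :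
    |t| * |β| < (theta1 d n B)⁻¹ := by
  have hθ : 0 < theta1 d n B := zero_lt_one.trans_le (one_le_theta1 d n B)
  have hR : 0 < |β| * theta1 d n B + 1 := by positivity
  have h1 : |t| * |β| * theta1 d n B < 1 :=
    calc |t| * |β| * theta1 d n B ≤ |t| * (|β| * theta1 d n B + 1) := by
          nlinarith [abs_nonneg t, abs_nonneg β, hθ.le]
      _ < (|β| * theta1 d n B + 1)⁻¹ * (|β| * theta1 d n B + 1) := mul_lt_mul_of_pos_right ht hR
      _ = 1 := inv_mul_cancel₀ hR.ne'
  rw [inv_eq_one_div, lt_div_iff₀ hθ]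
  exact h1

/-- **`SeriesConvergesFiniteVolume` for the Wilson action, with a volume-uniform radius (ours; PROVED).**
For every `d`, `n ≠ 0`, orthonormal basis `B` of `𝔰𝔲(n)` and coupling `β` there is `r > 0` — namely
`r = (|β| θ₁(d,n,B) + 1)⁻¹`, INDEPENDENT OF THE LATTICE SIZE — such that on every periodic lattice
`(ℤ/L)^d`, for every smooth Haar-normalised Lüscher series `(S̃^{(k)}, Ċ^{(k)})` of `S = β·S_W` (recursion
(4.12)–(4.15), normalisation of App. E.2) and every `|t| < r`: the value series `∑ |t|^k |S̃^{(k)}(ιU)|`, the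
gradient series `∑ |t|^k |∂^a_e S̃^{(k)}(ιU)|` and the constants' series `∑ |t|^k |Ċ^{(k)}|` converge, and the
sum `S̃_t = ∑ t^k S̃^{(k)}` solves Lüscher's flow equation `𝓛_t S̃_t = S + Ċ_t` (4.5) on `SU(n)^E` with
`Ċ_t = ∑ t^k Ċ^{(k)}`.  This is, word for word, the body of the cited statement `SeriesConvergesFiniteVolume`
(file B; Lüscher App. E proves it with an `L`-dependent radius) for the action `β·S_W`, obtained here from
THEOREM A instead of App. E.  (The general smooth action of the cited statement is NOT claimed.)
[ours; cite: Luscher2010Trivializing, §4.3, §4.5(b), App. E.2–E.3] -/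
theorem seriesConverges_smul_ambWilsonAction (hn : n ≠ 0) (β : ℝ) :
    ∃ r : ℝ, 0 < r ∧ ∀ (L : ℕ) [NeZero L] (Sk : ℕ → AmbConfig d L n → ℝ) (c : ℕ → ℝ),
      (∀ k, ContDiff ℝ ∞ (Sk k)) → IsLuscherSeries B (fun W => β * ambWilsonAction W) Sk c →
      IsHaarNormalised Sk →
      ∀ t : ℝ, |t| < r →
        (∀ U : GaugeConfig d L (Matrix.specialUnitaryGroup (Fin n) ℂ),
          Summable fun k => |t| ^ k * |Sk k (WilsonFlow.coeConfig U)|) ∧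
        (∀ (U : GaugeConfig d L (Matrix.specialUnitaryGroup (Fin n) ℂ)) (e : Edge d L) (a : B.ι),
          Summable fun k => |t| ^ k * |linkDeriv e (B.T a) (Sk k) (WilsonFlow.coeConfig U)|) ∧
        (Summable fun k => |t| ^ k * |c k|) ∧
        ∀ U : GaugeConfig d L (Matrix.specialUnitaryGroup (Fin n) ℂ),
          luscherL B (fun W => β * ambWilsonAction W) t (fun W => ∑' k, t ^ k * Sk k W)
              (WilsonFlow.coeConfig U) =
            β * ambWilsonAction (WilsonFlow.coeConfig U) + ∑' k, t ^ k * c k := by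
  have hθ1 : 1 ≤ theta1 d n B := one_le_theta1 d n B
  have hθ : 0 < theta1 d n B := zero_lt_one.trans_le hθ1
  refine ⟨(|β| * theta1 d n B + 1)⁻¹, inv_pos.2 (by positivity), ?_⟩
  intro L _ Sk c hsm h hN t ht
  have htβ : |t| * |β| < (theta1 d n B)⁻¹ := abs_mul_abs_lt_of_lt_radius B ht
  -- the graded comparison series `β^{k+1} S̃^{(k)}_graded`
  set Skβ : ℕ → AmbConfig d L n → ℝ := fun k W => β ^ (k + 1) * gradedSk (d := d) (L := L) B k W
    with hSkβ
  have hβser : IsLuscherSeries B (fun W => β * ambWilsonAction W) Skβ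
      (fun k => β ^ (k + 1) * gradedConst (d := d) (L := L) B k) := isLuscherSeries_smul_gradedSk B β
  have hsmβ : ∀ k, ContDiff ℝ ∞ (Skβ k) := contDiff_smul_gradedSk B β
  -- uniqueness: same constants, same gradients, values shifted by constants
  have hc : c = fun k => β ^ (k + 1) * gradedConst (d := d) (L := L) B k :=
    IsLuscherSeries.const_eq h hβser hsm hsmβ
  have hgrad : ∀ (k : ℕ) (e : Edge d L) (a : B.ι) (U : GaugeConfig d L (Matrix.specialUnitaryGroup (Fin n) ℂ)),
      linkDeriv e (B.T a) (Sk k) (WilsonFlow.coeConfig U) = linkDeriv e (B.T a) (Skβ k) (WilsonFlow.coeConfig U) :=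
    fun k e a U => (IsLuscherSeries.linkDeriv_eq h hβser hsm hsmβ k).2 e a U
  -- majorants of the graded series
  set A : ℝ := (Real.sqrt ((n : ℝ) / 4))⁻¹ * (Fintype.card (Edge d L) : ℝ) with hA
  set M₀ : ℕ → ℝ := fun k => |β| ^ (k + 1) * (A * (N0 d n * theta1 d n B ^ k)) with hM₀
  set M₁ : ℕ → ℝ := fun k => |β| ^ (k + 1) * (1 * (N0 d n * theta1 d n B ^ k)) with hM₁
  set M₂ : ℕ → ℝ := fun k => |β| ^ (k + 1) * ((((k : ℝ) + 1) * tauStar B) * (N0 d n * theta1 d n B ^ k))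
    with hM₂
  have hmaj := majorants_summable (L := L) B htβ
  have hsM₀ : Summable fun k => |t| ^ k * M₀ k := hmaj.1
  have hsM₁ : Summable fun k => |t| ^ k * M₁ k := hmaj.2.1
  have hsM₂ : Summable fun k => |t| ^ k * M₂ k := hmaj.2.2
  -- the value shift: `S̃^{(k)} = β^{k+1}S̃^{(k)}_graded + δ_k` on the manifold with `|δ_k| ≤ M₀ k`
  have hval : ∀ (k : ℕ) (U : GaugeConfig d L (Matrix.specialUnitaryGroup (Fin n) ℂ)),
      |Sk k (WilsonFlow.coeConfig U)| ≤ M₀ k + M₀ k := by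
    intro k U
    set δ : ℝ := Sk k (WilsonFlow.coeConfig fun _ => 1) - Skβ k (WilsonFlow.coeConfig fun _ => 1) with hδ
    have hsub : ∀ V : GaugeConfig d L (Matrix.specialUnitaryGroup (Fin n) ℂ),
        Sk k (WilsonFlow.coeConfig V) - Skβ k (WilsonFlow.coeConfig V) = δ :=
      fun V => IsLuscherSeries.sub_coeConfig_eq h hβser hsm hsmβ k V
    have hintβ : Integrable (fun V : GaugeConfig d L (Matrix.specialUnitaryGroup (Fin n) ℂ) =>
        Skβ k (WilsonFlow.coeConfig V)) (trivialMeasure (Matrix.specialUnitaryGroup (Fin n) ℂ) d L) :=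
      integrable_trivialMeasure_of_continuous ((hsmβ k).continuous.comp WilsonFlow.continuous_coeConfig)
    have hint : Integrable (fun V : GaugeConfig d L (Matrix.specialUnitaryGroup (Fin n) ℂ) =>
        Sk k (WilsonFlow.coeConfig V)) (trivialMeasure (Matrix.specialUnitaryGroup (Fin n) ℂ) d L) :=
      integrable_trivialMeasure_of_continuous ((hsm k).continuous.comp WilsonFlow.continuous_coeConfig)
    have hδeq : δ = -∫ V, Skβ k (WilsonFlow.coeConfig V)
        ∂(trivialMeasure (Matrix.specialUnitaryGroup (Fin n) ℂ) d L) := by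
      have h1 : ∫ V, (Sk k (WilsonFlow.coeConfig V) - Skβ k (WilsonFlow.coeConfig V))
          ∂(trivialMeasure (Matrix.specialUnitaryGroup (Fin n) ℂ) d L) = δ := by
        simp_rw [hsub]
        simp
      rw [← h1, integral_sub hint hintβ, hN k, zero_sub]
    have hδle : |δ| ≤ M₀ k := by
      rw [hδeq, abs_neg]
      have h2 := norm_integral_le_of_norm_le_const
        (μ := trivialMeasure (Matrix.specialUnitaryGroup (Fin n) ℂ) d L)
        (f := fun V : GaugeConfig d L (Matrix.specialUnitaryGroup (Fin n) ℂ) => Skβ k (WilsonFlow.coeConfig V))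
        (C := M₀ k) (Filter.Eventually.of_forall fun V => by
          rw [Real.norm_eq_abs]; exact abs_smul_gradedSk_le B hn β k V)
      simpa using h2
    have hv : Sk k (WilsonFlow.coeConfig U) = Skβ k (WilsonFlow.coeConfig U) + δ := by
      rw [← hsub U]; ring
    rw [hv]
    exact (abs_add_le _ _).trans (add_le_add (abs_smul_gradedSk_le B hn β k U) hδle)
  have hsM₀₀ : Summable fun k => |t| ^ k * (M₀ k + M₀ k) := by
    simpa only [mul_add] using hsM₀.add hsM₀
  -- gradients and repeated derivatives of `Sk` obey the graded majorants
  have h1 : ∀ (k : ℕ) (U : GaugeConfig d L (Matrix.specialUnitaryGroup (Fin n) ℂ)) (e : Edge d L) (a : B.ι),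
      |linkDeriv e (B.T a) (Sk k) (WilsonFlow.coeConfig U)| ≤ M₁ k := by
    intro k U e a
    rw [hgrad]
    exact abs_linkDeriv_smul_gradedSk_le B hn β k U e a
  have h2 : ∀ (k : ℕ) (U : GaugeConfig d L (Matrix.specialUnitaryGroup (Fin n) ℂ)) (e : Edge d L) (a : B.ι),
      |linkDeriv e (B.T a) (linkDeriv e (B.T a) (Sk k)) (WilsonFlow.coeConfig U)| ≤ M₂ k := by
    intro k U e a
    rw [linkDeriv_coeConfig_congr (φ := linkDeriv e (B.T a) (Sk k)) (ψ := linkDeriv e (B.T a) (Skβ k))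
      (fun V => hgrad k e a V) e (B.mem a) U]
    exact abs_linkDeriv_linkDeriv_smul_gradedSk_le B hn β k U e a
  have hcs : Summable fun k => |t| ^ k * |c k| := by
    rw [hc]
    exact summable_abs_smul_gradedConst B hn htβ
  refine ⟨fun U => ?_, fun U e a => ?_, hcs, fun U => ?_⟩
  · exact Summable.of_nonneg_of_le (fun k => by positivity)
      (fun k => mul_le_mul_of_nonneg_left (hval k U) (pow_nonneg (abs_nonneg t) k)) hsM₀₀
  · exact Summable.of_nonneg_of_le (fun k => by positivity)
      (fun k => mul_le_mul_of_nonneg_left (h1 k U e a) (pow_nonneg (abs_nonneg t) k)) hsM₁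
  · exact luscherL_tSeries_eq B h hsm hval h1 h2 hsM₀₀ hsM₁ hsM₂ hcs U

end GradedSeries

end Summit.Ventures.LatticeQCDFlow.TrivializingMaps

end
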